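import Literature.AlgebraicGeometry.Resolution.ResolutionOfSingularities
import Mathlib.AlgebraicGeometry.Geometrically.Irreducible
import Mathlib.AlgebraicGeometry.Morphisms.UniversallyOpen
import HarnessLib

/-!
# Geometric irreducibility passes to a scheme from a dense open subscheme, and along birational morphisms
# (over a field)

Topic `Literature/AlgebraicGeometry/Resolution`. THEOREMS only (no definition, no named fact). Written by the prover seat
`hodge-nonav-19716-p2` (g12, cell `hodge-nonav`) as brick QF-4 «GENERIC RESOLUTION», part L1 («GI-BIR»), of prover-Bx's
programme Q-FAMILY (memo `PROGRAMME-Q-FAMILY-Bx-g18.md` §6) for route `HodgeConjecture/Q8SymplecticPowers` (crux K1Q,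
stmt-HodgeConjecture-24190): the resolution `Y_K → 𝒱_K` of the generic quaternionic quartic must be GEOMETRICALLY IRREDUCIBLE over
`K` for the spreading-out step (`geometricallyIrreducible_of_genericFibre`, Stacks 0AY8) to apply.

* `geometricallyIrreducible_of_dense_opens` — over a FIELD `K`: if a DENSE open subscheme `Y' ⊆ Y` is geometrically irreducible over
  `K` (`GeometricallyIrreducible (Y'.ι ≫ q)`), then `Y` is (`GeometricallyIrreducible q`). Proof: for a field `F ⊇ K` the projection
  `Y_F → Y` is OPEN (every morphism to the spectrum of a field is universally open, Mathlib), so `Y'_F ⊆ Y_F` is a dense open; it is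
  the base change of `Y' → Spec K` (pasting `isPullback_morphismRestrict` onto the pullback square), hence irreducible; a space with a
  dense irreducible subset is irreducible. (Stacks, Tag 038F/054Q: geometric irreducibility is generic-point-local.)
* `geometricallyIrreducible_of_isBirational` — over a field `K`: if `π : Y ⟶ V` is BIRATIONAL (`IsBirational`: an isomorphism over a
  dense open `U ⊆ V` with `π⁻¹U` dense) and `V` is geometrically irreducible over `K`, then so is `Y`. Proof: `π⁻¹U ≅ U` and an open
  subscheme of a geometrically irreducible scheme which still surjects onto `Spec K` is geometrically irreducible (Mathlib), then
  `geometricallyIrreducible_of_dense_opens`.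
* `geometricallyIrreducible_of_isResolution` — the case of a resolution of singularities (`IsResolution`: proper, birational, regular
  source).

## References

* [StacksProject] The Stacks Project, Tag 038F (geometrically irreducible schemes), Tag 054Q, Tag 01RN (birational).
* [Kollar2007] J. Kollár, Lectures on Resolution of Singularities (2007), Thm. 3.36.
-/

noncomputable section

open CategoryTheory CategoryTheory.Limits AlgebraicGeometry TopologicalSpace

namespace Literature.AlgebraicGeometry.Resolution

universe u

variable {K : Type u} [Field K]

/-- **Geometric irreducibility from a dense open subscheme (over a field).** If `Y' ⊆ Y` is a dense open subscheme and
`Y' → Spec K` is geometrically irreducible, then `Y → Spec K` is geometrically irreducible: base change along a field extension is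
an open map, so `Y'_F` is a dense open of `Y_F`, and it is irreducible as the base change of `Y'`. [cite: StacksProject, Tag 038F] -/
theorem geometricallyIrreducible_of_dense_opens {Y : Scheme.{u}} (q : Y ⟶ Spec (.of K)) (Y' : Y.Opens)
    (hd : Dense (Y' : Set Y)) [hY' : GeometricallyIrreducible (Y'.ι ≫ q)] : GeometricallyIrreducible q := by
  refine ⟨fun F _ y Z fst snd h ↦ ?_⟩
  -- the projection `fst : Z ⟶ Y` of the base change is an open map (base change of `Spec F → Spec K`)
  haveI : Subsingleton ↥(Spec (CommRingCat.of K)) := inferInstanceAs (Subsingleton (PrimeSpectrum K))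
  haveI : UniversallyOpen y := inferInstance
  haveI : UniversallyOpen fst := MorphismProperty.of_isPullback h.flip inferInstance
  have hopen : IsOpenMap fst := fst.isOpenMap
  -- `Z' := fst⁻¹ Y'` is a dense open of `Z`
  have hdense : Dense ((fst ⁻¹ᵁ Y' : Z.Opens) : Set Z) := hd.preimage hopen
  -- and it is the base change of `Y' → Spec K` along `y`, hence irreducible
  have hsq : IsPullback (fst ∣_ Y') ((fst ⁻¹ᵁ Y').ι ≫ snd) (Y'.ι ≫ q) y :=
    (isPullback_morphismRestrict fst Y').paste_vert h
  have hirr : IrreducibleSpace ↥(fst ⁻¹ᵁ Y') := hY'.geometrically_irreducibleSpace y _ _ hsq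
  -- a space with a dense irreducible subset is irreducible
  have hirr' : IsIrreducible ((fst ⁻¹ᵁ Y' : Z.Opens) : Set Z) :=
    isIrreducible_iff_irreducibleSpace.mpr hirr
  have hcl : IsIrreducible (closure ((fst ⁻¹ᵁ Y' : Z.Opens) : Set Z)) := hirr'.closure
  rw [hdense.closure_eq] at hcl
  exact (irreducibleSpace_def Z).mpr hcl

/-- **Geometric irreducibility along a birational morphism (over a field).** If `π : Y ⟶ V` is birational
(`IsBirational`: `π` restricts to an isomorphism `π⁻¹U ≅ U` over a dense open `U ⊆ V` with `π⁻¹U` dense in `Y`) and `V → Spec K` is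
geometrically irreducible, then `Y → Spec K` is geometrically irreducible: `π⁻¹U ≅ U`, a non-empty open subscheme of a geometrically
irreducible `K`-scheme is geometrically irreducible, and `geometricallyIrreducible_of_dense_opens`.
[cite: StacksProject, Tag 038F and Tag 01RN] -/
theorem geometricallyIrreducible_of_isBirational {Y V : Scheme.{u}} (π : Y ⟶ V) (q : V ⟶ Spec (.of K))
    [hV : GeometricallyIrreducible q] (hπ : IsBirational π) : GeometricallyIrreducible (π ≫ q) := by
  obtain ⟨U, hUd, hU'd, hiso⟩ := hπ
  haveI := hiso
  -- `V` is irreducible, so the dense open `U` is non-empty and `U → Spec K` is surjective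
  haveI : Subsingleton ↥(Spec (CommRingCat.of K)) := inferInstanceAs (Subsingleton (PrimeSpectrum K))
  haveI : IrreducibleSpace V := GeometricallyIrreducible.irreducibleSpace_of_subsingleton (f := q)
  have hUne : ((U : Set V)).Nonempty := hUd.nonempty
  haveI : Surjective (U.ι ≫ q) := by
    refine ⟨fun s ↦ ?_⟩
    obtain ⟨v, hv⟩ := hUne
    refine ⟨⟨v, hv⟩, Subsingleton.elim _ _⟩
  -- `U → Spec K` is geometrically irreducible (open subscheme surjecting onto the base)
  haveI hU : GeometricallyIrreducible (U.ι ≫ q) := inferInstance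
  -- `π⁻¹U → Spec K` factors as the isomorphism `π ∣_ U` followed by `U → Spec K`
  have hfac : (π ⁻¹ᵁ U).ι ≫ (π ≫ q) = (π ∣_ U) ≫ (U.ι ≫ q) := by
    rw [← Category.assoc, ← morphismRestrict_ι, Category.assoc]
  haveI hY' : GeometricallyIrreducible ((π ⁻¹ᵁ U).ι ≫ (π ≫ q)) := by
    rw [hfac]
    haveI : MorphismProperty.RespectsIso @GeometricallyIrreducible :=
      MorphismProperty.IsStableUnderBaseChange.respectsIso
    exact (MorphismProperty.cancel_left_of_respectsIso @GeometricallyIrreducible (π ∣_ U) (U.ι ≫ q)).mpr hU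
  exact geometricallyIrreducible_of_dense_opens (π ≫ q) (π ⁻¹ᵁ U) hU'd

/-- **A resolution of singularities of a geometrically irreducible scheme over a field is geometrically irreducible**
(`IsResolution`: proper, birational, regular source). [cite: StacksProject, Tag 038F] [cite: Kollar2007, Thm. 3.36] -/
theorem geometricallyIrreducible_of_isResolution {Y V : Scheme.{u}} {π : Y ⟶ V} (q : V ⟶ Spec (.of K))
    [GeometricallyIrreducible q] (hπ : IsResolution π) : GeometricallyIrreducible (π ≫ q) :=
  geometricallyIrreducible_of_isBirational π q hπ.isBirational

end Literature.AlgebraicGeometry.Resolution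

end
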